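import Literature.NumberTheory.EllipticCurves.TwoVariableAnticyclotomicControl
import Literature.NumberTheory.EllipticCurves.HasseWeilAbelianEulerFactorEllipticSplitProofs
import Literature.NumberTheory.GaloisRepresentations.DecompositionGroupOfCompletion
import HarnessLib

/-!
# The cyclotomic `ℤ_p`-extension is unramified away from `p` (the cyclotomic case of the named fact
# `ZpExtension.inertia_le_kerSubgroup`), and the unramified local conditions away from `p` do not
# change between `K_∞^{(2)}` and the `ℤ_p²`-tower `K̃_∞` when `κ₁` is cyclotomic

`Proofs` file (theorems only; no definition, no named fact, no instance). Typed for the control of the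
two-variable Greenberg Selmer group `H¹_{nr,v̄}(K̃_∞, E[p^∞])` by the anticyclotomic line (BSD cell
`bsd-ssimc`, crux `AnticyclotomicEisensteinDivisibility`, stub `stub_torsionSS`; Summits helper
`…Theorems.SignedBaseChangeAcDivControlTorsion.xGr₂_isTorsion_of_isTorsion_XAc_of_local` reduces the
stub to one-variable torsion plus a LOCAL discrepancy between "Greenberg over `K̃_∞`" and Castella's
conditions over `K_∞⁻`). This file removes the `ℤ_p²`-tower from the AWAY-FROM-`p` part of that
discrepancy.

## What is printed, and what is proved

* L. Washington, *Introduction to Cyclotomic Fields*, Prop. 13.2: a `ℤ_p`-extension is unramified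
  outside `p` (tree named fact `ZpExtension.inertia_le_kerSubgroup`, class field theory, unproved).
  For the CYCLOTOMIC `ℤ_p`-extension no class field theory is needed: `K_∞^{cyc} ⊆ K(μ_{p^∞})` and
  inertia at `v ∤ p` fixes all `p`-power roots of unity (Serre, *Abelian ℓ-adic representations*,
  I.§1.2; tree theorem `GaloisRep.cyclotomicCharacter_eq_one_of_mem_inertia`). §1 proves
  **`inertia_le_kerSubgroup_of_isCyclotomic`**: `I_𝔓 ≤ ker κ` for `κ.IsCyclotomic`, `𝔓 ∣ v ∤ p` (the
  tree's `IsCyclotomic` is `ker κ = χ_p⁻¹(μ(ℤ_p))`), and its forms for the tree's chosen inertia group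
  `GreenbergSelmer.inertia v` (`= I_{𝔓₀}`, `𝔓₀ = adicCompletionPrime K v`) and for a pair:
  `I_v ⊓ ker κ₂ ≤ pairKer κ₁ κ₂`, `inertiaIn (pairKer κ₁ κ₂) v = inertiaIn (ker κ₂) v`.
* §2 (Greenberg–Vatsal 2000 §2 p. 17 formalism `unramifiedKer` / `unramifiedOutside`): for subgroups
  `H ≤ H'` of `Γ_K` with THE SAME trace on the inertia group at `v` (`inertiaIn H v = inertiaIn H' v`),
  a class of `H¹(H', M)` is unramified at the chosen place above `v` iff its restriction to `H` is
  (`resOfLe_mem_unramifiedKer_iff`, on explicit cocycles), hence — both subgroups normal —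
  `resOfLe_mem_unramifiedOutside_iff`. For the pair `(pairKer κ₁ κ₂ ≤ ker κ₂)` with `κ₁` cyclotomic:
  **`resOfLe_mem_unramifiedOutside_pairKer_iff`** — a class of `H¹(K_∞^{(2)}, M)` is unramified
  outside `p` over `K_∞^{(2)}` iff its restriction to `K̃_∞` is unramified outside `p` over `K̃_∞`.
  Consequently the away-from-`p` part of "res a is Greenberg over `K̃_∞`" is the ONE-variable
  condition "a is unramified outside `p` over `K_∞⁻`", whose comparison with Castella's "trivial away
  from `p`" is Castella 2018 §2.2 (`ℋ^ur_w`), a statement over `K_∞⁻` alone.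

Nothing here is specific to elliptic curves (`M` is any discrete `Γ_K`-module); nothing about BSD or
main conjectures is asserted.

References: [Washington1997] Prop. 13.2; [SerreAbelianLadic1968] Ch. I §1.2; [GreenbergVatsal2000]
§2 p. 17; [SkinnerUrban2014] §3.2.7 (p. 23); [Castella2018] §2.2 (arXiv:1704.06608 p. 7).
-/

noncomputable section

open scoped Classical

open NumberField IsDedekindDomain Field
open Literature.NumberTheory.GaloisRepresentations Literature.NumberTheory.EllipticCurves.GreenbergSelmer

universe u

namespace Literature.NumberTheory.EllipticCurves

/-! ## §1 The cyclotomic `ℤ_p`-extension is unramified away from `p` -/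

namespace ZpExtension

variable {K : Type u} [Field K] [NumberField K] {p : ℕ} [Fact p.Prime]

/-- **The cyclotomic `ℤ_p`-extension is unramified outside `p`** (the case `κ` cyclotomic of the named
fact `ZpExtension.inertia_le_kerSubgroup`, WITHOUT class field theory): for `𝔓 ∣ v ∤ p` the inertia group
`I_𝔓 ≤ Γ_K` lies in `ker κ = χ_p⁻¹(μ(ℤ_p))`, since `χ_p(I_𝔓) = 1`
(`GaloisRep.cyclotomicCharacter_eq_one_of_mem_inertia`). [cite: Washington1997, Prop. 13.2]
[cite: SerreAbelianLadic1968, Ch. I §1.2 (Example: the cyclotomic character)] -/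
theorem inertia_le_kerSubgroup_of_isCyclotomic (κ : ZpExtension K p) (hκ : κ.IsCyclotomic)
    {v : HeightOneSpectrum (𝓞 K)} (hv : (p : 𝓞 K) ∉ v.asIdeal)
    {𝔓 : Ideal (absIntegers (𝓞 K) K)} (h𝔓 : 𝔓 ∈ v.primesAbove) :
    𝔓.inertia (absoluteGaloisGroup K) ≤ κ.kerSubgroup := by
  intro σ hσ
  have h1 := GaloisRep.cyclotomicCharacter_eq_one_of_mem_inertia p hv h𝔓 hσ
  have hker : κ.kerSubgroup =
      (CommGroup.torsion ℤ_[p]ˣ).comap (GaloisRep.cyclotomicCharacter K p).toMonoidHom := hκ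
  rw [hker, Subgroup.mem_comap]
  show GaloisRep.cyclotomicCharacter K p σ ∈ CommGroup.torsion ℤ_[p]ˣ
  rw [h1]
  exact one_mem _

/-- The same for the tree's chosen inertia group `I_v = GreenbergSelmer.inertia v` (the image of the
local inertia group; `= I_{𝔓₀}` for `𝔓₀ = adicCompletionPrime K v`,
`inertia_adicCompletionPrime_eq_map_absInertia`): **`I_v ≤ ker κ` for `κ` cyclotomic and `v ∤ p`.**
[cite: Washington1997, Prop. 13.2] -/
theorem greenbergInertia_le_kerSubgroup_of_isCyclotomic (κ : ZpExtension K p) (hκ : κ.IsCyclotomic)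
    {v : HeightOneSpectrum (𝓞 K)} (hv : (p : 𝓞 K) ∉ v.asIdeal) :
    GreenbergSelmer.inertia v ≤ κ.kerSubgroup := by
  have e : GreenbergSelmer.inertia v = (adicCompletionPrime K v).inertia (absoluteGaloisGroup K) :=
    (inertia_adicCompletionPrime_eq_map_absInertia K v).symm
  rw [e]
  exact inertia_le_kerSubgroup_of_isCyclotomic κ hκ hv (adicCompletionPrime_mem_primesAbove K v)

/-- **`I_v ⊓ Gal(K̄/K_∞^{(2)}) ≤ Gal(K̄/K̃_∞)`** for `κ₁` cyclotomic and `v ∤ p`: the `ℤ_p²`-tower is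
unramified over `K_∞^{(2)}` away from `p`. [cite: Washington1997, Prop. 13.2] -/
theorem inertia_inf_kerSubgroup_le_pairKer {κ₁ : ZpExtension K p} (hκ₁ : κ₁.IsCyclotomic)
    (κ₂ : ZpExtension K p) {v : HeightOneSpectrum (𝓞 K)} (hv : (p : 𝓞 K) ∉ v.asIdeal) :
    GreenbergSelmer.inertia v ⊓ κ₂.kerSubgroup ≤ pairKer κ₁ κ₂ :=
  fun _ hσ ↦ Subgroup.mem_inf.mpr
    ⟨greenbergInertia_le_kerSubgroup_of_isCyclotomic κ₁ hκ₁ hv (Subgroup.mem_inf.mp hσ).1,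
      (Subgroup.mem_inf.mp hσ).2⟩

/-- **The inertia groups of `K̃_∞` and of `K_∞^{(2)}` at (the chosen place above) `v ∤ p` coincide**
inside `D_v`: `inertiaIn (pairKer κ₁ κ₂) v = inertiaIn (ker κ₂) v` for `κ₁` cyclotomic.
[cite: Washington1997, Prop. 13.2] [cite: GreenbergVatsal2000, §2 p. 17] -/
theorem inertiaIn_pairKer_eq {κ₁ : ZpExtension K p} (hκ₁ : κ₁.IsCyclotomic) (κ₂ : ZpExtension K p)
    {v : HeightOneSpectrum (𝓞 K)} (hv : (p : 𝓞 K) ∉ v.asIdeal) :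
    inertiaIn (pairKer κ₁ κ₂) v = inertiaIn κ₂.kerSubgroup v := by
  ext x
  rw [mem_inertiaIn_iff, mem_inertiaIn_iff]
  constructor
  · rintro ⟨hx, hI⟩
    exact ⟨pairKer_le_right κ₁ κ₂ hx, hI⟩
  · rintro ⟨hx, hI⟩
    exact ⟨inertia_inf_kerSubgroup_le_pairKer hκ₁ κ₂ hv (Subgroup.mem_inf.mpr ⟨hI, hx⟩), hI⟩

end ZpExtension

/-! ## §2 Unramified conditions along a restriction that does not change the inertia group -/

section Unramified

variable {K : Type u} [Field K] [NumberField K]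
  {M : Type u} [AddCommGroup M] [DistribMulAction (absoluteGaloisGroup K) M]
  [TopologicalSpace M] [DiscreteTopology M]

/-- **Unramifiedness is insensitive to a restriction that keeps the inertia group**: for `H ≤ H' ≤ Γ_K`
with `inertiaIn H v = inertiaIn H' v` (same trace on `I_v`), a class `a ∈ H¹(H', M)` is unramified at
the chosen place above `v` (`unramifiedKer H' M v`: its restriction to `H' ⊓ I_v` vanishes) iff
`res a ∈ H¹(H, M)` is (`unramifiedKer H M v`). On explicit cocycles both conditions read
"`z|_{H ⊓ I_v} = z|_{H' ⊓ I_v}` is a coboundary" (`map_oneCocycleClass`, `oneCocycleClass_eq_zero_iff`).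
[cite: GreenbergVatsal2000, §2 p. 17] -/
theorem resOfLe_mem_unramifiedKer_iff {H H' : Subgroup (absoluteGaloisGroup K)} (hle : H ≤ H')
    {v : HeightOneSpectrum (𝓞 K)} (hI : inertiaIn H v = inertiaIn H' v) (a : subgroupH1 H' M) :
    resOfLe M hle a ∈ GreenbergVatsal2000.unramifiedKer H M v ↔
      a ∈ GreenbergVatsal2000.unramifiedKer H' M v := by
  obtain ⟨z, rfl⟩ := oneCocycleClass_surjective _ a
  -- the two restrictions on cocycles
  have hres : resOfLe M hle (oneCocycleClass _ z) =
      oneCocycleClass _ (contOneCocycles.pullback (subgroupInclusion hle)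
        (resHomOfEquivariant (subgroupInclusion hle) (AddMonoidHom.id M) (fun _ _ ↦ rfl)) z) :=
    map_oneCocycleClass _ _ _ z
  have h1 : GreenbergVatsal2000.unramifiedKer H M v =
      (resH1Hom (inertiaInToH H v) (AddMonoidHom.id M) fun _ _ ↦ rfl).ker := rfl
  have h2 : GreenbergVatsal2000.unramifiedKer H' M v =
      (resH1Hom (inertiaInToH H' v) (AddMonoidHom.id M) fun _ _ ↦ rfl).ker := rfl
  rw [h1, h2, AddMonoidHom.mem_ker, AddMonoidHom.mem_ker, hres]
  unfold resH1Hom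
  erw [map_oneCocycleClass, map_oneCocycleClass]
  rw [oneCocycleClass_eq_zero_iff, oneCocycleClass_eq_zero_iff]
  constructor
  · rintro ⟨m, hm⟩
    refine ⟨m, fun x ↦ ?_⟩
    have hx : (x : decomp (K := K) v) ∈ inertiaIn H v := by rw [hI]; exact x.2
    exact hm ⟨x, hx⟩
  · rintro ⟨m, hm⟩
    refine ⟨m, fun x ↦ ?_⟩
    have hx : (x : decomp (K := K) v) ∈ inertiaIn H' v := by rw [← hI]; exact x.2
    exact hm ⟨x, hx⟩

/-- **`res a` is unramified outside `p` (and `S₀`) over `K̄^H` iff `a` is over `K̄^{H'}`**, for normal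
`H ≤ H'` with the same inertia groups at every finite `v ∤ p` off `S₀` (restriction commutes with
conjugation, `resOfLe_comp_conjH1`; then `resOfLe_mem_unramifiedKer_iff` place by place).
[cite: GreenbergVatsal2000, §2 pp. 16–17] -/
theorem resOfLe_mem_unramifiedOutside_iff {H H' : Subgroup (absoluteGaloisGroup K)} [H.Normal] [H'.Normal]
    (hle : H ≤ H') (p : ℕ) (S₀ : Set (HeightOneSpectrum (𝓞 K)))
    (hI : ∀ v : HeightOneSpectrum (𝓞 K), v ∉ S₀ → ((p : ℕ) : 𝓞 K) ∉ v.asIdeal →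
      inertiaIn H v = inertiaIn H' v)
    (a : subgroupH1 H' M) :
    resOfLe M hle a ∈ GreenbergVatsal2000.unramifiedOutside H M p S₀ ↔
      a ∈ GreenbergVatsal2000.unramifiedOutside H' M p S₀ := by
  rw [GreenbergVatsal2000.mem_unramifiedOutside_iff, GreenbergVatsal2000.mem_unramifiedOutside_iff]
  have hcomm : ∀ σ : absoluteGaloisGroup K,
      conjH1 H M σ (resOfLe M hle a) = resOfLe M hle (conjH1 H' M σ a) := fun σ ↦ by
    have h := congrArg (fun f ↦ f a) (resOfLe_comp_conjH1_holds (M := M) hle σ)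
    exact h.symm
  refine forall_congr' fun v ↦ forall_congr' fun hv ↦ forall_congr' fun hvp ↦
    forall_congr' fun σ ↦ ?_
  rw [hcomm σ]
  exact resOfLe_mem_unramifiedKer_iff hle (hI v hv hvp) _

/-- **Away from `p`, "Greenberg over the `ℤ_p²`-tower" is a ONE-variable condition**: for `κ₁`
cyclotomic and any `κ₂`, a class `a ∈ H¹(K_∞^{(2)}, M)` is unramified outside `p` (off `S₀`) over
`K_∞^{(2)} = K̄^{ker κ₂}` iff its restriction to `K̃_∞ = K̄^{pairKer κ₁ κ₂}` is unramified outside `p`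
(off `S₀`) over `K̃_∞` — the away-from-`p` local conditions of `unrSelmer₂ κ₁ κ₂ M v̄` pulled back to
`K_∞^{(2)}` are those of the one-variable Greenberg group (`KellerYin2024.unrSelmer`-type), so that the
away-from-`p` discrepancy with Castella's `Sel_v̄(K_∞^{(2)}, M)` ("trivial at `w ∤ p`") is Castella 2018
§2.2's `ℋ^ur_w` over `K_∞⁻`. [cite: Washington1997, Prop. 13.2] [cite: Castella2018, §2.2 (arXiv:1704.06608 p. 7)] -/
theorem resOfLe_mem_unramifiedOutside_pairKer_iff {p : ℕ} [Fact p.Prime] {κ₁ : ZpExtension K p}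
    (hκ₁ : κ₁.IsCyclotomic) (κ₂ : ZpExtension K p) (S₀ : Set (HeightOneSpectrum (𝓞 K)))
    (a : subgroupH1 κ₂.kerSubgroup M) :
    resOfLe M (ZpExtension.pairKer_le_right κ₁ κ₂) a ∈
        GreenbergVatsal2000.unramifiedOutside (ZpExtension.pairKer κ₁ κ₂) M p S₀ ↔
      a ∈ GreenbergVatsal2000.unramifiedOutside κ₂.kerSubgroup M p S₀ :=
  resOfLe_mem_unramifiedOutside_iff (ZpExtension.pairKer_le_right κ₁ κ₂) p S₀
    (fun _ _ hvp ↦ ZpExtension.inertiaIn_pairKer_eq hκ₁ κ₂ hvp) a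

end Unramified

end Literature.NumberTheory.EllipticCurves

end
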